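import Literature.Geometry.DiscreteGeometry.TwoShellPlacementCheck

/-!
# Local charts of two-shell-good configurations — the computable CERTIFICATE CHECKER

Topic `Literature/Geometry/DiscreteGeometry`, namespace `Literature.Geometry.DiscreteGeometry.TwoShellChart`; companion of
`TwoShellPlacementCheck.lean` (whose `√18` integer model — `IVec`, `sq`, `det3`, `cramer`, `fccList`, `hcpList`,
`commonsOf`, `flipVec`, `siteVec` — it reuses).  Requested by the chart step (`stub_labelledPlacement` of crux
`NashClassCertificates.NashNearField`, = `stub_chartCore` of crux `PhononSlackCertificates.NearFieldConvexity`) of the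
summit `AtomisticToContinuum/Crystallization`: around a particle whose `3`-ball is `1/20`-good, the eighteen witnessed
two-shell patterns of its pattern neighbours (PIVOTS) glue to one ideal Barlow template.  The folklore crystallography
behind it (Hales, *Dense Sphere Packings* §1.3: each close-packed layer offers two positions for the next; Conway–Sloane,
*SPLAG* Ch. 4 §6.3) becomes, for `1/20`-perturbed data, a FINITE constraint-satisfaction problem, which this file decides by
checking a certificate (a decision tree produced offline); the SOUNDNESS of every Boolean below (what `true` implies for real
configurations) is proved by the consumer, next to the stub.  Everything is computable and kernel-reducible (structural
recursion on lists, integer arithmetic only).  [folklore]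

**The discrete model.**  A pivot `v` (a point of the centre's pattern `cen`) carries its own witnessed pattern of type `t`
(`modelList t`), seen in the centre's frame through an unknown near-similarity `B`; the particles common to both patterns
(`commonsOf cen v`: the centre and the centre's pattern points at distance `1` from `v`) receive LABELS (their names in the
pivot's pattern), which are first-shell points and reproduce distance `1` exactly and distance `√2` up to the classes
`{√2, √(8/3), √3}` (`labelPairOK`); `enumCands` lists all such labellings.  Three labels `w₁ w₂ w₃` and Cramer's rule
`d • w = Σ λₖ • wₖ` place every label `w`: its particle lies within `num / (940 d)` of the model point `P / d`,
`P = d v + Σ λₖ (cₖ − v)`, `num = 47|d − Σλ| + 50|d| + Σ |λₖ|·(97 or 50)` (`placeLabel`; tolerances `1/20`, scale ratio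
`≤ 50/47`).  A pivot's PLACEMENT TABLE is the list of best such entries over a menu of triples (`richTable`).
**Eliminations.** A predicted particle robustly inside another pivot's completeness ball (`robustInside`) must be one of
that pivot's predicted particles, so two tables predicting it at incompatible places (`differs`) exclude each other
(`elimA`, `elimB`).  **Symmetry.** Labellings differing by a symmetry of the pivot's pattern (`symList`: the 48 signed
permutations for fcc, the 6 permutations for hcp) have the same tables (proved by the consumer); `checkOrbits` certifies an
orbit decomposition of the candidates of a pivot.  **Leaves.** A context (`flip`, Hägg letters `s₋₂ s₋₁ s₀ s₁`) fixes an
ideal template `ctxSite`; `leafOK` checks that every table entry is a template site adjacent to its pivot, that the sites of a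
table are distinct, the metric alternative (`E ≤ 2/5`, or the site is far: norm `> 43/20` and `> 100/47 + E`), and the two
bridge clauses (the centre's pattern consists exactly of the non-zero central sites).  `checkTree` runs the decision tree, `checkAllOrbits` the orbit decompositions.

## Mathlib / tree search
`TwoShellPlacementCheck` (part 1, the integer model and a per-pair check) is reused for its model; its `tripleVerdict` /
`checkPair` are not used (the decision tree subsumes the pair check).  Mathlib: `List.flatMap`, `List.all`, `Int.gcd`,
`List.isPerm`.  No real numbers occur in this file.

## References
* T. C. Hales, *Dense Sphere Packings: a blueprint for formal proofs* (2012), §1.3. [HalesDSP2012]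
* J. H. Conway, N. J. A. Sloane, *Sphere Packings, Lattices and Groups*, 3rd ed. (1999), Ch. 4 §6.3. [ConwaySloane1999]
-/

namespace Literature.Geometry.DiscreteGeometry.TwoShellChart

open TwoShellCheck

/-! ### Small integer helpers -/

/-- `|d|` by case distinction (kernel-friendly). [folklore] -/
def zabs (d : ℤ) : ℤ := if d < 0 then -d else d

/-! ### Labels of the common particles -/

/-- The first-shell points of a pattern list. [folklore] -/
def units (piv : List IVec) : List IVec := piv.filter fun w => sq w == 18

/-- Admissible pair of labels for two commons at model squared distance `D`: distinct; distance `1` is reproduced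
exactly; distance `√2` lands in `{√2, √(8/3), √3}` (squared model distances `36, 48, 54`). [folklore] -/
def labelPairOK (D S : ℤ) : Bool :=
  S != 0 && (if D == 18 then S == 18 else if D == 36 then (S == 36 || S == 48 || S == 54) else true)

/-- A new label `w` for the common `c` is admissible against the labels `phi` already given to the commons `cs`. [folklore] -/
def labelOK (cs phi : List IVec) (c w : IVec) : Bool :=
  (List.zip cs phi).all fun cw => labelPairOK (sq (vsub c cw.1)) (sq (vsub w cw.2))

/-- All admissible labellings of the commons `cs` by first-shell points `us` (aligned lists: the `k`-th label belongs to
the `k`-th common). [folklore] -/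
def enumCands (us : List IVec) : List IVec → List (List IVec)
  | [] => [[]]
  | c :: cs => (enumCands us cs).flatMap fun phi => (us.filter fun w => labelOK cs phi c w).map fun w => w :: phi

/-- The candidates of a pivot with (ordered) commons `cs`: admissible labellings for both pattern types
(`false` = fcc first). [folklore] -/
def candsOfCs (cs : List IVec) : List (Bool × List IVec) :=
  ((enumCands (units fccList) cs).map fun phi => (false, phi)) ++
    ((enumCands (units hcpList) cs).map fun phi => (true, phi))

/-- Remove the first occurrence of a vector from a list, if any. [folklore] -/
def ivErase (z : IVec) : List IVec → Option (List IVec)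
  | [] => none
  | z' :: l => if veq z z' then some l else (ivErase z l).map fun l' => z' :: l'

/-- Two lists of vectors are permutations of each other. [folklore] -/
def ivPerm : List IVec → List IVec → Bool
  | [], [] => true
  | [], _ :: _ => false
  | z :: l, m => match ivErase z m with
    | some m' => ivPerm l m'
    | none => false

/-! ### Cramer placements -/

/-- A placement entry `(P, d, num)`: the particle of the label lies within `num / (940 |d|)` of the model point `P / d`
(in units of the model scale `1/√18` for `P`, absolute for the error). [folklore] -/
abbrev Entry := IVec × ℤ × ℤ

/-- Index triples `i < j < k < n`, lexicographically. [folklore] -/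
def trips (n : ℕ) : List (ℕ × ℕ × ℕ) :=
  (List.range n).flatMap fun i => (List.range n).flatMap fun j => (List.range n).flatMap fun k =>
    if i < j ∧ j < k then [(i, j, k)] else []

/-- The tolerance weight of a common: `50` for the centre itself (exact position), `97` for a pattern particle. [folklore] -/
def cwt (c : IVec) : ℤ := if veq c (0, 0, 0) then 50 else 97

/-- **The Cramer placement** of the label `w` through the commons `tr = (i, j, k)` of the labelling `phi` of `cs`, pivot `v`:
`none` if an index is out of range or the three labels are coplanar. [folklore] -/
def placeLabel (cs phi : List IVec) (v : IVec) (tr : ℕ × ℕ × ℕ) (w : IVec) : Option Entry :=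
  match phi[tr.1]?, phi[tr.2.1]?, phi[tr.2.2]?, cs[tr.1]?, cs[tr.2.1]?, cs[tr.2.2]? with
  | some w1, some w2, some w3, some c1, some c2, some c3 =>
    let d := det3 w1 w2 w3
    if d == 0 then none else
    let l := cramer w1 w2 w3 w
    let P := vadd (vsmul d v)
      (vadd (vadd (vsmul l.1 (vsub c1 v)) (vsmul l.2.1 (vsub c2 v))) (vsmul l.2.2 (vsub c3 v)))
    let num := 47 * zabs (d - (l.1 + l.2.1 + l.2.2)) + 50 * zabs d +
      (zabs l.1 * cwt c1 + zabs l.2.1 * cwt c2 + zabs l.2.2 * cwt c3)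
    some (P, d, num)
  | _, _, _, _, _, _ => none

/-- Normal form of an entry: `d > 0` and `gcd (P, d, num) = 1` (same point, same error). [folklore] -/
def normEntry (e : Entry) : Entry :=
  let P := if e.2.1 < 0 then vsmul (-1) e.1 else e.1
  let d := zabs e.2.1
  let num := e.2.2
  let g : ℕ := Int.gcd (Int.gcd (Int.gcd P.1 P.2.1) (Int.gcd P.2.2 d)) num
  if g ≤ 1 then (P, d, num) else ((P.1 / g, P.2.1 / g, P.2.2 / g), d / g, num / g)

/-- Strictly smaller error `num/d` (for normalised entries). [folklore] -/
def betterE (e1 e2 : Entry) : Bool := e1.2.2 * e2.2.1 < e2.2.2 * e1.2.1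

/-- The best normalised placement of `w` over a menu of triples (`none` if no triple of the menu spans). [folklore] -/
def bestOverMenu (cs phi : List IVec) (v : IVec) (menu : List (ℕ × ℕ × ℕ)) (w : IVec) : Option Entry :=
  menu.foldl (fun acc tr =>
    match placeLabel cs phi v tr w with
    | none => acc
    | some e =>
      let e := normEntry e
      match acc with
      | none => some e
      | some b => if betterE e b then some e else some b) none

/-- **The placement table** of a labelling: the best entries of all eighteen labels of the pattern `piv`, in the order of
`piv` (`none` if some label cannot be placed through the menu). [folklore] -/
def richTable (cs phi : List IVec) (v : IVec) (piv : List IVec) (menu : List (ℕ × ℕ × ℕ)) : Option (List Entry) :=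
  piv.foldr (fun w acc =>
    match bestOverMenu cs phi v menu w, acc with
    | some e, some l => some (e :: l)
    | _, _ => none) (some [])

/-! ### Eliminations -/

/-- The entry's particle lies robustly inside the completeness ball of the pivot `q` and is not `q`'s own particle:
`‖P/d − q‖ + E + 1/20 ≤ 141/100` and `‖P/d − q‖ > E + 1/20` (`E = num/(940|d|)`, norms in units of `1/√18`·`√18`…: all
squared and cleared of denominators). [folklore] -/
def robustInside (e : Entry) (q : IVec) : Bool :=
  let ad := zabs e.2.1
  let num := e.2.2
  let rnum := 12784 * ad - 10 * num
  let D := sq (vsub e.1 (vsmul e.2.1 q))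
  (0 ≤ rnum) && (D * (9400 * 9400) ≤ 18 * (rnum * rnum)) && (D * (940 * 940) > 18 * ((num + 47 * ad) * (num + 47 * ad)))

/-- Two entries predict points farther apart than the sum of their errors. [folklore] -/
def differs (e e2 : Entry) : Bool :=
  let W := vsub (vsmul e2.2.1 e.1) (vsmul e.2.1 e2.1)
  let b := e.2.2 * zabs e2.2.1 + e2.2.2 * zabs e.2.1
  sq W * (940 * 940) > 18 * (b * b)

/-- Elimination of type A: an entry of the current pivot against the table of an assigned pivot `q`. [folklore] -/
def elimA (e : Entry) (q : IVec) (tableQ : List Entry) : Bool :=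
  robustInside e q && tableQ.all fun e2 => differs e e2

/-! ### Pattern symmetries -/

/-- The six coordinate permutations. [folklore] -/
def permApply (k : ℕ) (z : IVec) : IVec :=
  match k with
  | 0 => z
  | 1 => (z.1, z.2.2, z.2.1)
  | 2 => (z.2.1, z.1, z.2.2)
  | 3 => (z.2.1, z.2.2, z.1)
  | 4 => (z.2.2, z.1, z.2.1)
  | _ => (z.2.2, z.2.1, z.1)

/-- A signed permutation `(k, ε)` acting on `ℤ³`. [folklore] -/
def symApply (g : ℕ × IVec) (z : IVec) : IVec :=
  let p := permApply g.1 z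
  (g.2.1 * p.1, g.2.2.1 * p.2.1, g.2.2.2 * p.2.2)

/-- The symmetries used for each pattern type: all `48` signed permutations for fcc (the cuboctahedral group), the `6`
permutations for hcp (a subgroup of its `D₃ₕ`). [folklore] -/
def symList (hcp : Bool) : List (ℕ × IVec) :=
  if hcp then (List.range 6).map fun k => (k, ((1 : ℤ), (1 : ℤ), (1 : ℤ)))
  else (List.range 6).flatMap fun k =>
    [(1 : ℤ), -1].flatMap fun a => [(1 : ℤ), -1].flatMap fun b => [(1 : ℤ), -1].map fun c => (k, (a, b, c))

/-- Componentwise equality of label lists. [folklore] -/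
def phiEq : List IVec → List IVec → Bool
  | [], [] => true
  | a :: l, b :: m => veq a b && phiEq l m
  | _, _ => false

/-- **Orbit certificate check for one pivot.**  `cs` is an ordering of the commons of `p`, `reps` are labellings
(with types); `assign` gives, for every candidate of `candsOfCs cs` in order, the index of its representative and of the
symmetry carrying the representative to it. [folklore] -/
def checkOrbits (cen : List IVec) (p : IVec) (cs : List IVec) (reps : List (Bool × List IVec))
    (assign : List (ℕ × ℕ)) : Bool :=
  let cands := candsOfCs cs
  ivPerm cs (commonsOf cen p) && (cands.length == assign.length) &&
  (List.zip cands assign).all fun ca =>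
    match reps[ca.2.1]?, (symList ca.1.1)[ca.2.2]? with
    | some r, some g => (r.1 == ca.1.1) && phiEq ca.1.2 (r.2.map (symApply g))
    | _, _ => false

/-! ### Contexts and leaves -/

/-- A context: the sign flip (which body diagonal of the centre's frame is the layer normal) and the four Hägg letters
`s₋₂, s₋₁, s₀, s₁ ∈ {±1}` of the word around the central layer. [folklore] -/
abbrev Ctx := Fin 4 × ℤ × ℤ × ℤ × ℤ

/-- The layer label `haggLabel s m` of the context word for `m ∈ [-2, 2]` (and `0` elsewhere). [folklore] -/
def wordLabel (κ : Ctx) (m : ℤ) : ℤ :=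
  let sm2 := κ.2.1
  let sm1 := κ.2.2.1
  let s0 := κ.2.2.2.1
  let s1 := κ.2.2.2.2
  if m = 1 then s0 else if m = 2 then s0 + s1 else if m = -1 then -sm1 else if m = -2 then -sm1 - sm2 else 0

/-- The template site `(m, u, w)` of a context in the centre's model coordinates. [folklore] -/
def ctxSite (κ : Ctx) (m u w : ℤ) : IVec := flipVec κ.1 (siteVec m u w (wordLabel κ m))

/-- Exact division test `d ∣ P` and the quotient. [folklore] -/
def divEntry (e : Entry) : Option IVec :=
  let d := e.2.1
  if d == 0 then none else
  if e.1.1 % d == 0 && e.1.2.1 % d == 0 && e.1.2.2 % d == 0 then some (e.1.1 / d, e.1.2.1 / d, e.1.2.2 / d) else none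

/-- The metric alternative of an entry sitting at the site `z`: error `≤ 2/5`, or the site is far (`‖z‖ > 43/20` and
`‖z‖ > 100/47 + E`, so that neither metric condition of the stub applies). [folklore] -/
def metricOK (e : Entry) (z : IVec) : Bool :=
  let ad := zabs e.2.1
  let num := e.2.2
  (5 * num ≤ 2 * 940 * ad) ||
    ((84 ≤ sq z) && (sq z * ((47 * 940 * ad) * (47 * 940 * ad)) > 18 * ((100 * 940 * ad + 47 * num) * (100 * 940 * ad + 47 * num))))

/-- The points of a list are pairwise distinct. [folklore] -/
def pairwiseDistinct : List IVec → Bool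
  | [] => true
  | z :: l => l.all (fun z' => !(veq z z')) && pairwiseDistinct l

/-- Entry equality (componentwise). [folklore] -/
def entryEq (e e' : Entry) : Bool := veq e.1 e'.1 && e.2.1 == e'.2.1 && e.2.2 == e'.2.2

/-- Equality of entry lists. [folklore] -/
def tableEq : List Entry → List Entry → Bool
  | [], [] => true
  | e :: l, e' :: l' => entryEq e e' && tableEq l l'
  | _, _ => false

/-- One entry at a leaf: it sits EXACTLY at the context site `z` of its witness (`P = d • z`, `d > 0`), adjacent to the
pivot (`0 < sq (z − p) ≤ 40`), and satisfies the metric alternative. [folklore] -/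
def leafEntryOK (p : IVec) (e : Entry) (z : IVec) : Bool :=
  veq (vsmul e.2.1 z) e.1 && (0 < e.2.1) && (0 < sq (vsub z p)) && (sq (vsub z p) ≤ 40) && metricOK e z

/-- The sites of the witnesses of a table. [folklore] -/
def leafSites (κ : Ctx) (wit : List (ℤ × ℤ × ℤ)) : List IVec :=
  wit.map fun muw => ctxSite κ muw.1 muw.2.1 muw.2.2

/-- A site witness has its layer index in `[-2, 2]` (where `wordLabel` is the word's label). [folklore] -/
def layerOK (muw : ℤ × ℤ × ℤ) : Bool := (-2 ≤ muw.1) && (muw.1 ≤ 2)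

/-- One table at a leaf: every entry passes `leafEntryOK` at its witnessed site (layers in `[-2, 2]`) and the sites are
pairwise distinct. [folklore] -/
def leafTableOK (κ : Ctx) (p : IVec) (T : List Entry) (wit : List (ℤ × ℤ × ℤ)) : Bool :=
  (T.length == wit.length) && wit.all layerOK &&
    (List.zip T (leafSites κ wit)).all (fun ez => leafEntryOK p ez.1 ez.2) &&
    pairwiseDistinct (leafSites κ wit)

/-- The bridge clauses of a context: (i) every point of the centre's pattern is a template site (witnesses), and (ii) every
non-zero central site (`12‖·‖² ≤ 27`, layers `−1, 0, 1`) is a point of the centre's pattern. [folklore] -/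
def bridgeOK (cen : List IVec) (κ : Ctx) (witI : List (ℤ × ℤ × ℤ)) : Bool :=
  (cen.length == witI.length) && witI.all layerOK &&
  ((List.zip cen witI).all fun cw => veq (ctxSite κ cw.2.1 cw.2.2.1 cw.2.2.2) cw.1) &&
  ([-1, 0, 1].all fun m =>
    ((List.range 11).map fun i => (i : ℤ) - 5).all fun u =>
      ((List.range 7).map fun i => (i : ℤ) - 3).all fun w =>
        let L := wordLabel κ m
        let N := 3 * (2 * u + w + L) * (2 * u + w + L) + (3 * w + L) * (3 * w + L) + 8 * m * m
        !(1 ≤ N && N ≤ 27) || lmem (ctxSite κ m u w) cen)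

/-- The word of a context is a Hägg word (letters `±1`) and the flip index is in range. [folklore] -/
def ctxValid (κ : Ctx) : Bool :=
  [κ.2.1, κ.2.2.1, κ.2.2.2.1, κ.2.2.2.2].all fun s => s == 1 || s == -1

/-! ### The decision tree -/

/-- Actions of a node on one representative labelling of its pivot. [folklore] -/
inductive Action where
  /-- eliminated (type A): label index `wi`, triple `tr`, against assigned pivot `qi` -/
  | elimA (wi : ℕ) (tr : ℕ × ℕ × ℕ) (qi : ℕ) : Action
  /-- eliminated (type B): entry `ei` of assigned pivot `qi` against all eighteen placements (triples `trs`) -/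
  | elimB (qi ei : ℕ) (trs : List (ℕ × ℕ × ℕ)) : Action
  /-- kept: a new class (its placement table is computed with the node's menu) -/
  | keep : Action
  /-- kept: same placement table (up to order) as the earlier kept representative number `k` -/
  | dup (k : ℕ) : Action
  deriving Repr

/-- Certificates: a node (pivot, menu, one action per representative, one subtree per kept class) or a leaf (context
and site witnesses). [folklore] -/
inductive Cert where
  /-- a node: pivot, menu of triples, one action per representative, one subtree per kept class -/
  | node (p : IVec) (menu : List (ℕ × ℕ × ℕ)) (acts : List Action) (subs : List Cert) : Cert
  /-- a leaf: context, site witnesses of every table (in assignment order), site witnesses of the centre's pattern -/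
  | leaf (κ : Ctx) (wits : List (List (ℤ × ℤ × ℤ))) (witI : List (ℤ × ℤ × ℤ)) : Cert
  deriving Repr

/-- An assigned pivot: its model point, its pattern type and its placement table. [folklore] -/
abbrev Assigned := IVec × Bool × List Entry

/-- The per-pivot data fed to the tree: pivot, its ordered commons, and its orbit representatives. [folklore] -/
abbrev PivotReps := IVec × List IVec × List (Bool × List IVec)

/-- Look up the ordered commons and the representatives of a pivot. [folklore] -/
def repsOf (data : List PivotReps) (p : IVec) : Option (List IVec × List (Bool × List IVec)) :=
  (data.find? fun d => veq d.1 p).map fun d => d.2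

/-- Remove the first entry equal to `e` from a table, if any. [folklore] -/
def tableErase (e : Entry) : List Entry → Option (List Entry)
  | [] => none
  | e' :: l => if entryEq e e' then some l else (tableErase e l).map fun l' => e' :: l'

/-- Two tables are permutations of each other (as multisets of entries). [folklore] -/
def tablePerm : List Entry → List Entry → Bool
  | [], [] => true
  | [], _ :: _ => false
  | e :: l, m => match tableErase e m with
    | some m' => tablePerm l m'
    | none => false

/-- Boolean: the action eliminates or keeps the representative `(t, phi)` correctly, returning the table if kept as a new
class (`some (some T)`), `some none` if eliminated/duplicate-checked, `none` on failure. [folklore] -/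
def runAction (cs : List IVec) (p : IVec) (menu : List (ℕ × ℕ × ℕ)) (assigned : List Assigned)
    (keptTables : List (Bool × List Entry)) (t : Bool) (phi : List IVec) : Action → Option (Option (List Entry))
  | .elimA wi tr qi =>
    match (modelList t)[wi]?, assigned[qi]? with
    | some w, some q =>
      match placeLabel cs phi p tr w with
      | some e => if elimA e q.1 q.2.2 then some none else none
      | none => none
    | _, _ => none
  | .elimB qi ei trs =>
    match assigned[qi]? with
    | some q =>
      match q.2.2[ei]? with
      | some e =>
        let piv := modelList t
        if robustInside e p && (trs.length == piv.length) &&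
            (List.zip piv trs).all (fun wt =>
              match placeLabel cs phi p wt.2 wt.1 with
              | some ep => differs e ep
              | none => false)
        then some none else none
      | none => none
    | none => none
  | .keep =>
    match richTable cs phi p (modelList t) menu with
    | some T => some (some T)
    | none => none
  | .dup k =>
    match keptTables[k]?, richTable cs phi p (modelList t) menu with
    | some kT, some T => if (kT.1 == t) && tablePerm T kT.2 then some none else none
    | _, _ => none

/-- Process the representatives of a node with their actions; returns the kept classes `(t, T)` in order, or `none`. [folklore] -/
def runNode (cs : List IVec) (p : IVec) (menu : List (ℕ × ℕ × ℕ)) (assigned : List Assigned) :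
    List (Bool × List IVec) → List Action → List (Bool × List Entry) → Option (List (Bool × List Entry))
  | [], [], kept => some kept
  | (t, phi) :: reps, a :: acts, kept =>
    match runAction cs p menu assigned kept t phi a with
    | some (some T) => runNode cs p menu assigned reps acts (kept ++ [(t, T)])
    | some none => runNode cs p menu assigned reps acts kept
    | none => none
  | _, _, _ => none

/-- All entries of `l` satisfy `f` with their index. [folklore] -/
def allIdx {α : Type} (f : ℕ → α → Bool) : ℕ → List α → Bool
  | _, [] => true
  | i, a :: l => f i a && allIdx f (i + 1) l

/-- **The tree checker** (`fuel` bounds the depth).  A node: its pivot is a new point of `cen`, its commons are the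
commons, its representatives are processed by their actions, and every kept class has a checked subtree.  A leaf: a valid
context, all of `cen` assigned, every table passes `leafTableOK`, and the bridge clauses hold. [folklore] -/
def checkTree (cen : List IVec) (data : List PivotReps) : ℕ → List Assigned → Cert → Bool
  | 0, _, _ => false
  | _ + 1, assigned, .leaf κ wits witI =>
    ctxValid κ && (assigned.length == cen.length) && (wits.length == assigned.length) &&
      (List.zip assigned wits).all (fun aw => leafTableOK κ aw.1.1 aw.1.2.2 aw.2) && bridgeOK cen κ witI
  | fuel + 1, assigned, .node p menu acts subs =>
    lmem p cen && !(assigned.any fun q => veq q.1 p) &&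
    match repsOf data p with
    | none => false
    | some (cs, reps) =>
      ivPerm cs (commonsOf cen p) &&
      match runNode cs p menu assigned reps acts [] with
      | none => false
      | some kept =>
        (kept.length == subs.length) &&
        allIdx (fun i tT =>
          match subs[i]? with
          | some c => checkTree cen data fuel (assigned ++ [(p, tT.1, tT.2)]) c
          | none => false) 0 kept

/-- **Orbit certificate check for all pivots**: `assigns` lists, for every pivot of `cen` in order, the orbit assignment of
its candidates. [folklore] -/
def checkAllOrbits (cen : List IVec) (data : List PivotReps) (assigns : List (IVec × List (ℕ × ℕ))) : Bool :=
  (assigns.length == cen.length) &&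
  (List.zip cen assigns).all fun pa =>
    veq pa.1 pa.2.1 &&
    match repsOf data pa.1 with
    | some (cs, reps) => checkOrbits cen pa.1 cs reps pa.2.2
    | none => false

end Literature.Geometry.DiscreteGeometry.TwoShellChart
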